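import Literature.Probability.RandomPlanarGeometry.HexParafermionLoop
import HarnessLib

/-!
# The vertex relation of the parafermionic observable with a SURFACE FUGACITY (Beaton's weight `y`)

Topic `Literature/Probability/RandomPlanarGeometry` (continues `HexSAWObservable.lean` — the classes `clsIn/clsOut/clsLoop`,
the triplet identity `triplet_sum`, the generic triplet grouping `sum_clsOut_eq`, `sum_cv_comm` — and `HexParafermionLoop.lean`
— the pair cancellation `pair_sum_of_wnd` and Lemma 1 `vertex_relation_of_wnd` under the winding hypothesis).  Sources:
N. R. Beaton, *The critical surface fugacity of self-avoiding walks on a rotated honeycomb lattice*, J. Phys. A 47 (2014)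
075003 (arXiv:1210.0274v3), §2.4 «Including surface interactions: general y» and the proof of Proposition 6 (pp. 9–10):
"we associate the surface fugacity `y` with vertices on the β boundary … When `y ≠ 1` the contribution of the weighted β
vertices will not be 0"; N. R. Beaton, M. Bousquet-Mélou, J. de Gier, H. Duminil-Copin, A. J. Guttmann, CMP 326 (2014)
(arXiv:1109.0358), §3 (the same device in the Duminil-Copin–Smirnov frame); H. Duminil-Copin, S. Smirnov, Ann. of Math.
175 (2012), Lemma 1.

## What is proved (lane «pcv-sawmu», door R96 «BEATON-YC», face K96.0 «WEIGHTED VERTEX RELATION»; generic form)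

Fix a finite domain `V ∌ a⁻` whose simple cycles do not wind around the cell right of `a` (the hypothesis of
`vertex_relation_of_wnd`), a set `S` of SURFACE vertices and a fugacity `y`.  Weight every walk `γ` by
`swt S y γ = y^{#(inner vertices of γ in S)}` on top of DCS's `x_c^ℓ λ^{turning}`.  Then for every `v ∈ V`
(`vertex_relation_weighted`):

  `Σ_γ c_v(γ) · swt(γ) = [v ∈ S] · (1 − y) · Σ_{γ ∈ clsIn V v} (t − v) · x_c^ℓ λ^{W} · swt(γ)`,

i.e. Lemma 1 holds verbatim at vertices off the surface, and at a surface vertex the triplets leave the defect `(1 − y)` times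
the weighted sum over the walks arriving at `v` for the first time (Beaton: the groups `γ₁, γ₁ˡ, γ₁ʳ` contribute
`x^{|γ₁|} y^{c(γ₁)} (j̄λ^{−π/6} + x y j λ^{π/6} + x y λ^{−π/2})`, which is `(1 − y)` times the first term since the `y = 1`
bracket vanishes).  Mechanism: the weight is CONSTANT on DCS's pairs (same vertex set: `swt_loopRev`) and on the two
prolongations of a triplet, which carry one extra factor `y^{[v ∈ S]}` relative to the unprolonged walk
(`swt_append_singleton`).  Summing over `v ∈ V` (`boundary_sum_weighted`): the weighted boundary sum equals the start
direction plus `(1 − y)` times the surface defect `Σ_{v ∈ V ∩ S} Σ_{clsIn V v} …`.  Printed for Beaton's rotated strip with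
`S = β` (the top row) inside the proof of Proposition 6; the generic statement is a consolidation step (first kernel text).

## Contents (namespace `Literature.Probability.RandomPlanarGeometry.SAW.HV`, all PROVED)

`swt`, `swt_trivial`, `swt_append_singleton`, `swt_lw_reverse`, `sum_cv_swt_eq`, `sum_clsLoop_swt_eq_zero_of_wnd`,
`triplet_sum_swt`, **`vertex_relation_weighted`**, `sum_cv_swt_comm`, **`boundary_sum_weighted`**; and the same in the
half-plane frame of the tree's `vertex_relation` (`sum_clsLoop_swt_eq_zero_upper`, **`vertex_relation_weighted_upper`**,
**`boundary_sum_weighted_upper`**) for the Duminil-Copin–Smirnov strips `stripV T L`.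
-/

noncomputable section

open Finset Literature.Probability.LatticeModels Literature.Probability.Percolation

namespace Literature.Probability.RandomPlanarGeometry.SAW

namespace HV

/-! ### The surface weight -/

/-- **Beaton's surface weight** `y^{c(γ)}`, `c(γ)` = the number of (inner) vertices of the walk lying on the surface `S`
("a variable `y` keeping track of the number of surface contacts"). [cite: Beaton2014RotatedHoneycomb, §2.4 (arXiv v3 p. 8: "x^{|γ|} n^{ℓ(γ)} y^{c(γ)}")] -/
def swt (S : Finset HV) (y : ℂ) (P : List HV) : ℂ := y ^ ((inner P).countP (· ∈ S))

/-- The trivial walk has no surface contact. [cite: Beaton2014RotatedHoneycomb, §2.4] -/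
@[simp] theorem swt_trivial (S : Finset HV) (y : ℂ) : swt S y [wOut, hvOrigin] = 1 := by
  simp [swt, inner]

/-- Prolonging a walk through `v` multiplies the surface weight by `y^{[v ∈ S]}`.
[cite: Beaton2014RotatedHoneycomb, §2.4, proof of Proposition 6 (the extensions γ₁ˡ, γ₁ʳ carry one more factor x y)] -/
theorem swt_append_singleton (S : Finset HV) (y : ℂ) {P : List HV} {v t : HV} (h : inner (P ++ [t]) = inner P ++ [v]) :
    swt S y (P ++ [t]) = swt S y P * (if v ∈ S then y else 1) := by
  rw [swt, swt, h, List.countP_append]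
  by_cases hv : v ∈ S
  · simp [hv, pow_succ]
  · simp [hv]

/-- The two walks of a DCS pair have the same surface weight (same vertices). [cite: DuminilCopinSmirnov2012, proof of Lemma 1 (pairs)] -/
theorem swt_lw_reverse (S : Finset HV) (y : ℂ) (l₁ : List HV) (v : HV) (l₂ : List HV) :
    swt S y (lw l₁ v l₂.reverse) = swt S y (lw l₁ v l₂) := by
  rw [swt, swt, inner_lw, inner_lw]
  congr 1
  have hperm : (l₁ ++ v :: l₂.reverse).Perm (l₁ ++ v :: l₂) :=
    List.Perm.append_left l₁ (List.Perm.cons v (List.reverse_perm l₂))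
  exact hperm.countP_eq _

/-! ### The weighted vertex relation -/

section Weighted

variable {V : Finset HV} {v : HV}

/-- Splitting the weighted left-hand side by the three classes (the weight rides along).
[cite: DuminilCopinSmirnov2012, proof of Lemma 1] -/
theorem sum_cv_swt_eq (V : Finset HV) (v : HV) (S : Finset HV) (y : ℂ) :
    ∑ P ∈ midWalks V, cv v P * swt S y P =
    ∑ P ∈ clsOut V v, edir v (finalDart P).2 * pwt P * swt S y P +
      (∑ P ∈ clsIn V v, edir v (finalDart P).1 * pwt P * swt S y P +
        ∑ P ∈ clsLoop V v, edir v (finalDart P).1 * pwt P * swt S y P) := by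
  have h1 : ∀ P ∈ midWalks V, cv v P * swt S y P =
      (if (finalDart P).1 = v then edir v (finalDart P).2 * pwt P * swt S y P else 0) +
      ((if (finalDart P).2 = v ∧ v ∉ inner P then edir v (finalDart P).1 * pwt P * swt S y P else 0) +
        (if (finalDart P).2 = v ∧ v ∈ inner P then edir v (finalDart P).1 * pwt P * swt S y P else 0)) := by
    intro P hP
    have hne := (mem_midWalks_iff.1 hP).finalDart_fst_ne_snd
    unfold cv
    by_cases ha : (finalDart P).1 = v
    · have hb : (finalDart P).2 ≠ v := fun hb => hne (ha.trans hb.symm)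
      simp [ha, hb]
    · by_cases hb : (finalDart P).2 = v
      · by_cases hc : v ∈ inner P <;> simp [ha, hb, hc]
      · simp [ha, hb]
  rw [sum_congr rfl h1, sum_add_distrib, sum_add_distrib, clsOut, clsIn, clsLoop, sum_filter,
    sum_filter, sum_filter]

/-- **Weighted pairs contribute zero** (the weight is constant on each pair).
[cite: DuminilCopinSmirnov2012, proof of Lemma 1 (pairs); Beaton2014RotatedHoneycomb, proof of Proposition 6] -/
theorem sum_clsLoop_swt_eq_zero_of_wnd (hw : wOut ∉ V)
    (h₀ : ∀ c : List HV, (∀ x ∈ c, x ∈ V) → IsCyc c → wnd c (1, 0) = 0) (v : HV) (S : Finset HV) (y : ℂ) :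
    ∑ P ∈ clsLoop V v, edir v (finalDart P).1 * pwt P * swt S y P = 0 := by
  refine Finset.sum_involution (fun P _ => loopRev v P) (fun P hP => ?_) (fun P hP _ => ?_)
    (fun P hP => ?_) (fun P hP => ?_)
  · obtain ⟨l₁, l₂, hv₁, rfl⟩ := exists_eq_lw hP
    rw [loopRev_lw hv₁, swt_lw_reverse, ← add_mul, pair_sum_of_wnd hw h₀ (mem_midWalks_iff.1 (mem_filter.1 hP).1),
      zero_mul]
  · obtain ⟨l₁, l₂, hv₁, rfl⟩ := exists_eq_lw hP
    rw [loopRev_lw hv₁]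
    exact lw_rev_ne (mem_midWalks_iff.1 (mem_filter.1 hP).1)
  · obtain ⟨l₁, l₂, hv₁, rfl⟩ := exists_eq_lw hP
    have hPw := mem_midWalks_iff.1 (mem_filter.1 hP).1
    have h2 := lw_two_le hPw
    have hl₂ : l₂.reverse ≠ [] := by
      intro h; rw [List.reverse_eq_nil_iff] at h; subst h; simp at h2
    rw [loopRev_lw hv₁, clsLoop, mem_filter, mem_midWalks_iff, finalDart_lw _ _ hl₂, inner_lw]
    exact ⟨lw_rev_isMidWalk hPw, rfl, by simp⟩
  · obtain ⟨l₁, l₂, hv₁, rfl⟩ := exists_eq_lw hP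
    simp only [loopRev_lw hv₁, List.reverse_reverse]

/-- **The weighted triplet**: at `v ∉ S` the three contributions cancel as in DCS; at `v ∈ S` the two prolongations carry
an extra `y`, and since the `y = 1` bracket vanishes the group leaves `(1 − y)` times its first term.
[cite: Beaton2014RotatedHoneycomb, proof of Proposition 6 (the bracket j̄λ^{−π/6} + x y j λ^{π/6} + x y λ^{−π/2})] -/
theorem triplet_sum_swt (hvV : v ∈ V) {P : List HV} (hP : P ∈ clsIn V v) (S : Finset HV) (y : ℂ) :
    edir v (finalDart P).1 * pwt P * swt S y P +
      (edir v (finalDart (P ++ [ccw v (finalDart P).1])).2 * pwt (P ++ [ccw v (finalDart P).1]) *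
          swt S y (P ++ [ccw v (finalDart P).1]) +
        edir v (finalDart (P ++ [cw v (finalDart P).1])).2 * pwt (P ++ [cw v (finalDart P).1]) *
          swt S y (P ++ [cw v (finalDart P).1])) =
      (if v ∈ S then (1 - y) else 0) * (edir v (finalDart P).1 * pwt P * swt S y P) := by
  have htrip := triplet_sum hvV hP
  have hP' := hP
  rw [clsIn, mem_filter, mem_midWalks_iff] at hP'
  obtain ⟨hPw, hv, hvi⟩ := hP'
  have ht : hvGraph.Adj v (finalDart P).1 := hv ▸ hPw.adj_finalDart.symm
  obtain ⟨-, -, -, i₁⟩ := hPw.append_singleton hv hvV hvi (adj_ccw v _) (ccw_ne v _)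
  obtain ⟨-, -, -, i₂⟩ := hPw.append_singleton hv hvV hvi (adj_cw v _) (cw_ne ht)
  rw [swt_append_singleton S y i₁, swt_append_singleton S y i₂]
  by_cases hS : v ∈ S
  · rw [if_pos hS, if_pos hS]
    linear_combination (swt S y P * y) * htrip
  · rw [if_neg hS, if_neg hS]
    linear_combination (swt S y P) * htrip

/-- **The vertex relation with a surface fugacity** (face K96.0 of the lane's R96): for `v ∈ V`,
`Σ_γ c_v(γ) y^{c(γ)} = [v ∈ S] (1 − y) Σ_{γ ∈ clsIn V v} (t − v) x_c^ℓ λ^{W(γ)} y^{c(γ)}` — Lemma 1 off the surface, the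
`(1 − y)`-defect on it. [cite: Beaton2014RotatedHoneycomb, §2.4, proof of Proposition 6 (arXiv v3 pp. 9–10)] [cite: DuminilCopinSmirnov2012, Lemma 1] -/
theorem vertex_relation_weighted (hw : wOut ∉ V)
    (h₀ : ∀ c : List HV, (∀ x ∈ c, x ∈ V) → IsCyc c → wnd c (1, 0) = 0) (hvV : v ∈ V) (S : Finset HV) (y : ℂ) :
    ∑ P ∈ midWalks V, cv v P * swt S y P =
      (if v ∈ S then (1 - y) else 0) * ∑ P ∈ clsIn V v, edir v (finalDart P).1 * pwt P * swt S y P := by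
  rw [sum_cv_swt_eq, sum_clsLoop_swt_eq_zero_of_wnd hw h₀ v S y, add_zero,
    sum_clsOut_eq hw hvV (fun Q => edir v (finalDart Q).2 * pwt Q * swt S y Q), add_comm, ← sum_add_distrib, mul_sum]
  exact sum_congr rfl fun P hP => triplet_sum_swt hvV hP S y

/-- Summing the weighted contributions of one walk over all vertices: the weight factors out of `sum_cv_comm`.
[cite: DuminilCopinSmirnov2012, proof of Lemma 2] -/
theorem sum_cv_swt_comm (V : Finset HV) (P : List HV) (S : Finset HV) (y : ℂ) :
    ∑ v ∈ V, cv v P * swt S y P =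
      ((if (finalDart P).1 ∈ V then edir (finalDart P).1 (finalDart P).2 else 0) +
        (if (finalDart P).2 ∈ V then edir (finalDart P).2 (finalDart P).1 else 0)) * pwt P * swt S y P := by
  rw [← sum_mul, sum_cv_comm]

/-- **The weighted boundary sum** (discrete Stokes with a surface fugacity): the sum over the nontrivial walks whose final
half-edge leaves `V` of `(direction) · x_c^ℓ λ^{W} · y^{c}` equals the start direction PLUS `(1 − y)` times the surface
defect `Σ_{v ∈ V, v ∈ S} Σ_{γ ∈ clsIn V v} (t − v) x_c^ℓ λ^W y^c`.  Beaton evaluates the defect for the rotated strip with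
`S = β` via `Γ¹, Γ²` (proof of Proposition 6); here it is left as is. [cite: Beaton2014RotatedHoneycomb, §2.4, proof of Proposition 6 ("the contribution of the weighted β vertices will not be 0, but … can instead be written as a multiple of B_{T,L}")] [cite: DuminilCopinSmirnov2012, proof of Lemma 2 (eq. (5))] -/
theorem boundary_sum_weighted (hw : wOut ∉ V)
    (h₀ : ∀ c : List HV, (∀ x ∈ c, x ∈ V) → IsCyc c → wnd c (1, 0) = 0) (hO : hvOrigin ∈ V) (S : Finset HV) (y : ℂ) :
    ∑ P ∈ (midWalks V).filter (fun P => P ≠ [wOut, hvOrigin] ∧ (finalDart P).2 ∉ V),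
        edir (finalDart P).1 (finalDart P).2 * pwt P * swt S y P =
      edir wOut hvOrigin +
        (1 - y) * ∑ v ∈ V.filter (· ∈ S), ∑ P ∈ clsIn V v, edir v (finalDart P).1 * pwt P * swt S y P := by
  have h0 : ∑ P ∈ midWalks V, ∑ v ∈ V, cv v P * swt S y P =
      (1 - y) * ∑ v ∈ V.filter (· ∈ S), ∑ P ∈ clsIn V v, edir v (finalDart P).1 * pwt P * swt S y P := by
    rw [sum_comm, sum_filter, mul_sum]
    refine sum_congr rfl fun v hv => ?_
    rw [vertex_relation_weighted hw h₀ hv S y]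
    split_ifs <;> ring
  have h1 : ∀ P ∈ midWalks V, ∑ v ∈ V, cv v P * swt S y P =
      (if P = [wOut, hvOrigin] then edir hvOrigin wOut else 0) +
      (if P ≠ [wOut, hvOrigin] ∧ (finalDart P).2 ∉ V then
        edir (finalDart P).1 (finalDart P).2 * pwt P * swt S y P else 0) := by
    intro P hP
    rw [mem_midWalks_iff] at hP
    rw [sum_cv_swt_comm]
    by_cases ht : P = [wOut, hvOrigin]
    · subst ht
      simp [finalDart_trivial, hw, hO, pwt]
    · have h1 : (finalDart P).1 ∈ V := finalDart_fst_mem hP ht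
      by_cases h2 : (finalDart P).2 ∈ V
      · simp only [h1, h2, if_true, ht, if_false, not_true_eq_false, and_false, add_zero,
          ne_eq, not_false_eq_true, edir_rev (finalDart P).1 (finalDart P).2, add_neg_cancel,
          zero_mul]
      · simp [h1, h2, ht]
  rw [sum_congr rfl h1, sum_add_distrib, sum_ite_eq' (midWalks V) [wOut, hvOrigin],
    if_pos (mem_midWalks_iff.2 (isMidWalk_trivial V)), ← sum_filter] at h0
  rw [edir_rev hvOrigin wOut]
  linear_combination h0

/-! ### The same in the half-plane frame of Duminil-Copin–Smirnov (hypothesis `0 ≤ x₁` on `V`, the tree's `vertex_relation`) -/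

/-- Weighted pairs vanish in the half-plane frame (the tree's `pair_sum`). [cite: DuminilCopinSmirnov2012, proof of Lemma 1 (pairs)] -/
theorem sum_clsLoop_swt_eq_zero_upper (hV : ∀ w ∈ V, 0 ≤ w.2.1) (v : HV) (S : Finset HV) (y : ℂ) :
    ∑ P ∈ clsLoop V v, edir v (finalDart P).1 * pwt P * swt S y P = 0 := by
  refine Finset.sum_involution (fun P _ => loopRev v P) (fun P hP => ?_) (fun P hP _ => ?_)
    (fun P hP => ?_) (fun P hP => ?_)
  · obtain ⟨l₁, l₂, hv₁, rfl⟩ := exists_eq_lw hP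
    rw [loopRev_lw hv₁, swt_lw_reverse, ← add_mul, pair_sum hV (mem_midWalks_iff.1 (mem_filter.1 hP).1), zero_mul]
  · obtain ⟨l₁, l₂, hv₁, rfl⟩ := exists_eq_lw hP
    rw [loopRev_lw hv₁]
    exact lw_rev_ne (mem_midWalks_iff.1 (mem_filter.1 hP).1)
  · obtain ⟨l₁, l₂, hv₁, rfl⟩ := exists_eq_lw hP
    have hPw := mem_midWalks_iff.1 (mem_filter.1 hP).1
    have h2 := lw_two_le hPw
    have hl₂ : l₂.reverse ≠ [] := by
      intro h; rw [List.reverse_eq_nil_iff] at h; subst h; simp at h2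
    rw [loopRev_lw hv₁, clsLoop, mem_filter, mem_midWalks_iff, finalDart_lw _ _ hl₂, inner_lw]
    exact ⟨lw_rev_isMidWalk hPw, rfl, by simp⟩
  · obtain ⟨l₁, l₂, hv₁, rfl⟩ := exists_eq_lw hP
    simp only [loopRev_lw hv₁, List.reverse_reverse]

/-- **The vertex relation with a surface fugacity, half-plane frame** (domains of the tree's `stripV` type).
[cite: BeatonBousquetMelouDeGierDuminilCopinGuttmann2014, Lemma 3 (the local identity; second part: surface vertices)] [cite: DuminilCopinSmirnov2012, Lemma 1] -/
theorem vertex_relation_weighted_upper (hV : ∀ w ∈ V, 0 ≤ w.2.1) (hvV : v ∈ V) (S : Finset HV) (y : ℂ) :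
    ∑ P ∈ midWalks V, cv v P * swt S y P =
      (if v ∈ S then (1 - y) else 0) * ∑ P ∈ clsIn V v, edir v (finalDart P).1 * pwt P * swt S y P := by
  have hw := wOut_not_mem_of_upper hV
  rw [sum_cv_swt_eq, sum_clsLoop_swt_eq_zero_upper hV v S y, add_zero,
    sum_clsOut_eq hw hvV (fun Q => edir v (finalDart Q).2 * pwt Q * swt S y Q), add_comm, ← sum_add_distrib, mul_sum]
  exact sum_congr rfl fun P hP => triplet_sum_swt hvV hP S y

/-- **The weighted boundary sum, half-plane frame**: `Σ_{exits} edir·x_c^ℓλ^W·y^c = e₀ + (1 - y)·(surface defect)`.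
[cite: BeatonBousquetMelouDeGierDuminilCopinGuttmann2014, proof of Proposition 4 (the sum S computed two ways)] [cite: DuminilCopinSmirnov2012, proof of Lemma 2 (eq. (5))] -/
theorem boundary_sum_weighted_upper (hV : ∀ w ∈ V, 0 ≤ w.2.1) (hO : hvOrigin ∈ V) (S : Finset HV) (y : ℂ) :
    ∑ P ∈ (midWalks V).filter (fun P => P ≠ [wOut, hvOrigin] ∧ (finalDart P).2 ∉ V),
        edir (finalDart P).1 (finalDart P).2 * pwt P * swt S y P =
      edir wOut hvOrigin +
        (1 - y) * ∑ v ∈ V.filter (· ∈ S), ∑ P ∈ clsIn V v, edir v (finalDart P).1 * pwt P * swt S y P := by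
  have hw := wOut_not_mem_of_upper hV
  have h0 : ∑ P ∈ midWalks V, ∑ v ∈ V, cv v P * swt S y P =
      (1 - y) * ∑ v ∈ V.filter (· ∈ S), ∑ P ∈ clsIn V v, edir v (finalDart P).1 * pwt P * swt S y P := by
    rw [sum_comm, sum_filter, mul_sum]
    refine sum_congr rfl fun v hv => ?_
    rw [vertex_relation_weighted_upper hV hv S y]
    split_ifs <;> ring
  have h1 : ∀ P ∈ midWalks V, ∑ v ∈ V, cv v P * swt S y P =
      (if P = [wOut, hvOrigin] then edir hvOrigin wOut else 0) +
      (if P ≠ [wOut, hvOrigin] ∧ (finalDart P).2 ∉ V then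
        edir (finalDart P).1 (finalDart P).2 * pwt P * swt S y P else 0) := by
    intro P hP
    rw [mem_midWalks_iff] at hP
    rw [sum_cv_swt_comm]
    by_cases ht : P = [wOut, hvOrigin]
    · subst ht
      simp [finalDart_trivial, hw, hO, pwt]
    · have h1 : (finalDart P).1 ∈ V := finalDart_fst_mem hP ht
      by_cases h2 : (finalDart P).2 ∈ V
      · simp only [h1, h2, if_true, ht, if_false, not_true_eq_false, and_false, add_zero,
          ne_eq, not_false_eq_true, edir_rev (finalDart P).1 (finalDart P).2, add_neg_cancel,
          zero_mul]
      · simp [h1, h2, ht]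
  rw [sum_congr rfl h1, sum_add_distrib, sum_ite_eq' (midWalks V) [wOut, hvOrigin],
    if_pos (mem_midWalks_iff.2 (isMidWalk_trivial V)), ← sum_filter] at h0
  rw [edir_rev hvOrigin wOut]
  linear_combination h0

end Weighted

end HV

end Literature.Probability.RandomPlanarGeometry.SAW
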